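import Literature.Computability.Cryptography.ShorAssemblyClassicalBase
import Literature.Computability.QuantumComplexity.CWrapAssembly
import Literature.Computability.QuantumComplexity.CoinFamilyKernel
import HarnessLib

/-!
# Shor's factoring theorem, FBQP form: the two remaining leaves

Family `PQC`; fourth assembly file of `Literature/Computability/Cryptography/Shor.lean` for the named
facts `Literature.Computability.Cryptography.isQSolvable_factoring` / `factoring_mem_FBQP` (Shor 1997, §5:
the prime factorisation is computable in bounded-error quantum polynomial time, FBQP form over the
tree's poly-time-uniform Clifford+T model) and `FACT_mem_BQP` (decision form).

`ShorAssemblyClassicalBase.lean` obtains `isQSolvable_factoring` from classical wrapping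
(`isQSolvable_classicalWrap`) and the classical-base principle (`isQSolvable_of_mem_FPRel_BQP`), the
latter proved there from the two closure facts of `ShorAssembly.lean` (`isQSolvable_of_mem_BQP_oracle`,
`kernelProb_ge_uniformProb_of_mem_FPRel`). Since then classical wrapping has been DISCHARGED
(`isQSolvable_classicalWrap_holds`, `QuantumComplexity/CWrapAssembly.lean`), and the probability half of
the coin/oracle-simulation fact has been proved (`QuantumComplexity/CoinFamilyKernel.lean`,
`exists_uniform_kernelProb_ge_uniformProb`) from the named fact
`Literature.Computability.QuantumComplexity.uniformOracleCoinSimulation` (Bernstein–Vazirani 1997,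
Thm. 8.3 relativised: the uniform reversible simulation, with oracle gates, of an `FP^A` function of
`⟨input, coins⟩`). This file records the resulting implications, all proved:

* `kernelProb_ge_uniformProb_of_mem_FPRel_of_sim :
    uniformOracleCoinSimulation → kernelProb_ge_uniformProb_of_mem_FPRel` (the fact of
  `ShorAssembly.lean` is subsumed by the fact of `CoinFamilyKernel.lean`);
* `isQSolvable_of_mem_FPRel_BQP_of_leaves :
    isQSolvable_of_mem_BQP_oracle → uniformOracleCoinSimulation → isQSolvable_of_mem_FPRel_BQP`;
* **`isQSolvable_factoring_of_leaves`**, `factoring_mem_FBQP_of_leaves`, `FACT_mem_BQP_of_leaves`: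
  Shor's theorem (both FBQP forms and the decision form) from exactly two named facts, neither
  specific to factoring — `isQSolvable_of_mem_BQP_oracle` (Bennett–Bernstein–Brassard–Vazirani 1997,
  Thm. 4.14 / Cor. 4.15, `BQP^BQP = BQP` for extension-closed search relations with slack) and
  `uniformOracleCoinSimulation` (Bernstein–Vazirani 1997, Thm. 8.3 with §8.3). Every Shor-specific
  part — the randomised reduction to order finding and its recursion to a complete factorisation
  (`ShorFactoring`), the classical programs (`ShorStepFP`, `ShorOrdPost`, `OrderFindingPostFP`),
  Kitaev's order-finding family, its uniformity and its analysis (`ShorOrderFindingQuantum`,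
  `KitaevFamilyUniform`, `ShorOrderFindingTheorem`) — is proved in the tree, so the discharge
  `isQSolvable_factoring_holds` is `isQSolvable_factoring_of_leaves` applied to the two `_holds` of
  those facts once they land.

Deliberately NOT here: any new named fact (the two leaves are existing facts of the tree), and any
restatement of the leaves.

## References

* P. W. Shor, *Polynomial-time algorithms for prime factorization and discrete logarithms on a
  quantum computer*, SIAM J. Comput. 26 (1997) 1484–1509, §5 (pp. 13–16 of arXiv:quant-ph/9508027:
  "using randomization, factorization can be reduced to finding the order of an element [Mill]; …
  we now describe the algorithm for finding the order of `x (mod n)` on a quantum computer")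
  [Shor1997SICOMP].
* C. H. Bennett, E. Bernstein, G. Brassard, U. Vazirani, *Strengths and weaknesses of quantum
  computing*, SIAM J. Comput. 26 (1997) 1510–1523, Thm. 4.14 and Cor. 4.15 (`BQP^BQP = BQP`)
  [BennettBernsteinBrassardVazirani1997].
* E. Bernstein, U. Vazirani, *Quantum complexity theory*, SIAM J. Comput. 26 (1997) 1411–1473,
  Thm. 8.3 (`BPP ⊆ BQP`) and §8.3 (oracle quantum Turing machines) [BernsteinVazirani1997SICOMP].
-/

noncomputable section

namespace Literature.Computability.Cryptography

open _root_.Computability Complexity QuantumComplexity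

/-- **The coin/oracle-simulation fact of `ShorAssembly.lean` follows from the relativised reversible
simulation** `uniformOracleCoinSimulation` of `CoinFamilyKernel.lean`: for `G ∈ FP^A` and a coin
polynomial `q`, the coin family "Hadamard on each coin wire, then the simulating classical part"
is uniform and satisfies `Pr_c[G ⟨x, c⟩ ∈ S] ≤ Pr[the output has a prefix in S]`
(`exists_uniform_kernelProb_ge_uniformProb`, whose conclusion is verbatim the body of
`kernelProb_ge_uniformProb_of_mem_FPRel`). [cite: BernsteinVazirani1997SICOMP, Thm. 8.3 (proof) with §8.3 (oracle QTMs)] -/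
theorem kernelProb_ge_uniformProb_of_mem_FPRel_of_sim (hsim : uniformOracleCoinSimulation) :
    kernelProb_ge_uniformProb_of_mem_FPRel := fun A G q hG =>
  exists_uniform_kernelProb_ge_uniformProb hsim A G q hG

/-- **The classical-base principle from the two leaves**: "`BPP^{BQP}` search problems with an
extension-closed relation and success `≥ 3/4` are in `FBQP`" (`isQSolvable_of_mem_FPRel_BQP`) follows
from the `BQP`-subroutine fact `isQSolvable_of_mem_BQP_oracle` and the relativised reversible
simulation `uniformOracleCoinSimulation` (through `isQSolvable_of_mem_FPRel_BQP_of` and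
`kernelProb_ge_uniformProb_of_mem_FPRel_of_sim`). [cite: BennettBernsteinBrassardVazirani1997, Cor. 4.15 (BQP^BQP = BQP) with Thm. 4.14] -/
theorem isQSolvable_of_mem_FPRel_BQP_of_leaves (hsub : isQSolvable_of_mem_BQP_oracle)
    (hsim : uniformOracleCoinSimulation) : isQSolvable_of_mem_FPRel_BQP :=
  isQSolvable_of_mem_FPRel_BQP_of hsub (kernelProb_ge_uniformProb_of_mem_FPRel_of_sim hsim)

/-- **Shor's theorem, FBQP form, from the two remaining leaves.** The prime factorisation
`Nat.primeFactorsList ∘ decodeNat` is computable in bounded-error quantum polynomial time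
(`isQSolvable_factoring`: a poly-time uniform, oracle-free Clifford+T family outputs, with probability
`≥ 2/3`, a string with prefix the encoding of the list of prime factors), granted the `BQP`-subroutine
fact `isQSolvable_of_mem_BQP_oracle` (BBBV 1997, Cor. 4.15) and the relativised reversible simulation
`uniformOracleCoinSimulation` (Bernstein–Vazirani 1997, Thm. 8.3): by
`isQSolvable_factoring_of_wrap_base` (`ShorAssemblyClassicalBase.lean`) with the discharged classical
wrapping `isQSolvable_classicalWrap_holds` (`CWrapAssembly.lean`) and
`isQSolvable_of_mem_FPRel_BQP_of_leaves`. Shor's own line — reduce factoring to order finding by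
randomisation (after Miller 1976), find orders on the quantum computer, classical post-processing —
is the proved content behind `isQSolvable_factoring_of_wrap_base`.
[cite: Shor1997SICOMP, §5 (pp. 13–16 of arXiv:quant-ph/9508027: factoring in quantum polynomial time)] -/
theorem isQSolvable_factoring_of_leaves (hsub : isQSolvable_of_mem_BQP_oracle)
    (hsim : uniformOracleCoinSimulation) : isQSolvable_factoring :=
  isQSolvable_factoring_of_wrap_base isQSolvable_classicalWrap_holds
    (isQSolvable_of_mem_FPRel_BQP_of_leaves hsub hsim)

/-- The same for the `FBQP`-membership form `factoring_mem_FBQP` (definitionally `isQSolvable_factoring`,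
`factoring_mem_FBQP_iff_isQSolvable_factoring`). [cite: Shor1997SICOMP, §5 (factoring in quantum polynomial time)] -/
theorem factoring_mem_FBQP_of_leaves (hsub : isQSolvable_of_mem_BQP_oracle)
    (hsim : uniformOracleCoinSimulation) : factoring_mem_FBQP :=
  factoring_mem_FBQP_iff_isQSolvable_factoring.2 (isQSolvable_factoring_of_leaves hsub hsim)

/-- **Shor's theorem `FACT ∈ BQP` from the two remaining leaves** (`FACT_mem_BQP_of_wrap_base`,
`ShorAssemblyClassicalBase.lean`, with `isQSolvable_classicalWrap_holds` and
`isQSolvable_of_mem_FPRel_BQP_of_leaves`). [cite: Shor1997SICOMP, §5 (decision form)] -/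
theorem FACT_mem_BQP_of_leaves (hsub : isQSolvable_of_mem_BQP_oracle)
    (hsim : uniformOracleCoinSimulation) : FACT_mem_BQP :=
  FACT_mem_BQP_of_wrap_base isQSolvable_classicalWrap_holds
    (isQSolvable_of_mem_FPRel_BQP_of_leaves hsub hsim)

end Literature.Computability.Cryptography

end
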